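import Summits.FinalStateConjecture.FinalStateConjecture.Theorems.StarvedNecksGapDecaySufficesRelabelPullbackNorms

/-!
# Route StarvedNecks — crux `GapDecaySuffices` (stmt-FinalStateConjecture-18060), line `Sketch`:
# parity-relabel bricks (3/3) for `stub_assembly`: relabelled charts `Ψ ∘ Q̃`, transfer of chart clauses

For a parity datum `P : ParityDatum Λ` (file 1/3) and a chart `Ψ` on the boosted Kerr exterior of `(Λ, c)`,
the RELABELLED CHART `relabelChart P c M a Ψ := Ψ ∘ Q̃` lives on the exterior of `(Λ Q, c)` (same open set,
same clock and radius; `reflDom` is `Q̃` between the two domains).  Smoothness / open-embedding / image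
clauses transfer; `d(Ψ ∘ Q̃)_x((ΛQ)∂₀) = dΨ_{Q̃x}(Λ∂₀)` (future-directedness clauses transfer verbatim); the
zero-extended deviation of `Ψ ∘ Q̃` from the relabelled background is the pullback along `Q̃` of that of `Ψ`
(`deviationExtend_relabelChart`, registered brick `stub_deviationExtendParity`), so all `Cᵏ` sup norms over
`(t, r, x⁰)`-defined sets are unchanged (G3 / K8 / K9 / `Hf`(3)-shape, `tendsto_truncDeviationCk`).
Mathlib + `Literature.Geometry.Lorentzian.BackgroundChartCalculus` + file (1/3); no named facts, no `sorry`.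
References: O'Neill 1983, Ch. 9; DHRT arXiv:2104.08222 §1 (the `Cᵏ` deviation currency).
-/

noncomputable section

open scoped Manifold ContDiff Topology ENNReal RealInnerProductSpace
open Filter Set Function Topology Literature.Geometry.Lorentzian

namespace Summit.FinalStateConjecture.FinalStateConjecture.Theorems.GapDecaySuffices.Relabel

set_option linter.dupNamespace false

/-! ## §4 Relabelled charts: `Ψ ∘ Q̃` on the exterior of the relabelled motion -/

section ChartTransfer

variable {𝓢 : Spacetime.{0} 4} {Λ : lorentzGroup} (P : ParityDatum Λ) (c : E4) (M a : ℝ)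

/-- `Q̃` from the domain of the relabelled background to that of the original one (same open set). [folklore] -/
def reflDom (x : (boostedKerrBackground (relabelMotion P) c M a).domain) :
    (boostedKerrBackground Λ c M a).domain :=
  ⟨reflAffine P c x.1, (mem_boostedKerrExterior_reflAffine_iff P c M a x.1).2
    ((mem_boostedKerrExterior_relabelMotion_iff P c M a x.1).1 x.2)⟩

/-- … and back. [folklore] -/
def reflDom' (x : (boostedKerrBackground Λ c M a).domain) :
    (boostedKerrBackground (relabelMotion P) c M a).domain :=
  ⟨reflAffine P c x.1, (mem_boostedKerrExterior_relabelMotion_iff P c M a _).2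
    ((mem_boostedKerrExterior_reflAffine_iff P c M a x.1).2 x.2)⟩

/-- Underlying point of `reflDom x` is `Q̃ x`. [folklore] -/
@[simp] theorem reflDom_val (x : (boostedKerrBackground (relabelMotion P) c M a).domain) :
    (reflDom P c M a x).1 = reflAffine P c x.1 := rfl

/-- Underlying point of `reflDom' x` is `Q̃ x`. [folklore] -/
@[simp] theorem reflDom'_val (x : (boostedKerrBackground Λ c M a).domain) :
    (reflDom' P c M a x).1 = reflAffine P c x.1 := rfl

/-- `reflDom ∘ reflDom' = id`. [folklore] -/
@[simp] theorem reflDom_reflDom' (x : (boostedKerrBackground Λ c M a).domain) :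
    reflDom P c M a (reflDom' P c M a x) = x := Subtype.ext (reflAffine_reflAffine P c x.1)

/-- `reflDom' ∘ reflDom = id`. [folklore] -/
@[simp] theorem reflDom'_reflDom (x : (boostedKerrBackground (relabelMotion P) c M a).domain) :
    reflDom' P c M a (reflDom P c M a x) = x := Subtype.ext (reflAffine_reflAffine P c x.1)

/-- `Q̃` between the two (equal) domains is a homeomorphism. [folklore] -/
def reflDomHomeo : (boostedKerrBackground (relabelMotion P) c M a).domain ≃ₜ (boostedKerrBackground Λ c M a).domain where
  toFun := reflDom P c M a
  invFun := reflDom' P c M a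
  left_inv := reflDom'_reflDom P c M a
  right_inv := reflDom_reflDom' P c M a
  continuous_toFun := (continuous_reflAffine P c).comp continuous_subtype_val |>.subtype_mk _
  continuous_invFun := (continuous_reflAffine P c).comp continuous_subtype_val |>.subtype_mk _

/-- `reflDom` is surjective. [folklore] -/
theorem reflDom_surjective : Function.Surjective (reflDom P c M a) := (reflDomHomeo P c M a).surjective

/-- Images of `Q̃`-invariant coordinate sets: `reflDom '' S' = S` if `Q̃ x ∈ S ↔ x ∈ S'`. [folklore] -/
theorem image_reflDom_eq {S' : Set (boostedKerrBackground (relabelMotion P) c M a).domain}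
    {S : Set (boostedKerrBackground Λ c M a).domain} (h : ∀ x, reflDom P c M a x ∈ S ↔ x ∈ S') :
    reflDom P c M a '' S' = S := by
  ext z
  constructor
  · rintro ⟨x, hx, rfl⟩; exact (h x).2 hx
  · intro hz
    obtain ⟨x, rfl⟩ := reflDom_surjective P c M a z
    exact ⟨x, (h x).1 hz, rfl⟩

/-- `Q̃` is smooth between the domains. [folklore] -/
theorem contMDiff_reflDom : ContMDiff 𝓘(ℝ, E4) 𝓘(ℝ, E4) ∞ (reflDom P c M a) := by
  intro x
  rw [contMDiffAt_iff_target]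
  refine ⟨(reflDomHomeo P c M a).continuous.continuousAt, ?_⟩
  rw [OpensChart.extChartAt_coe]
  exact (OpensChart.contMDiffAt_iff x _ (reflAffine P c) (fun _ ↦ rfl)).2 (contDiff_reflAffine P c).contDiffAt

/-- **The relabelled chart** `Ψ ∘ Q̃` on the exterior of the relabelled motion `(Λ Q, c)`. [folklore] -/
def relabelChart (Ψ : (boostedKerrBackground Λ c M a).domain → 𝓢.carrier) :
    (boostedKerrBackground (relabelMotion P) c M a).domain → 𝓢.carrier :=
  Ψ ∘ reflDom P c M a

variable (Ψ : (boostedKerrBackground Λ c M a).domain → 𝓢.carrier)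

/-- Images under the relabelled chart are images under `Ψ` of `Q̃`-images. [folklore] -/
theorem image_relabelChart (S' : Set (boostedKerrBackground (relabelMotion P) c M a).domain) :
    relabelChart P c M a Ψ '' S' = Ψ '' (reflDom P c M a '' S') := by
  rw [relabelChart, Set.image_comp]

/-- Smooth charts relabel to smooth charts. [folklore] -/
theorem contMDiff_relabelChart (hΨ : ContMDiff 𝓘(ℝ, E4) (𝓡 4) ∞ Ψ) :
    ContMDiff 𝓘(ℝ, E4) (𝓡 4) ∞ (relabelChart P c M a Ψ) :=
  hΨ.comp (contMDiff_reflDom P c M a)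

/-- Charts smooth on `U` relabel to charts smooth on `Q̃⁻¹ U`. [folklore] -/
theorem contMDiffOn_relabelChart {U : Set (boostedKerrBackground Λ c M a).domain}
    (hΨ : ContMDiffOn 𝓘(ℝ, E4) (𝓡 4) ∞ Ψ U) :
    ContMDiffOn 𝓘(ℝ, E4) (𝓡 4) ∞ (relabelChart P c M a Ψ) (reflDom P c M a ⁻¹' U) :=
  hΨ.comp (contMDiff_reflDom P c M a).contMDiffOn fun _ hx ↦ hx

/-- `Q̃ (Q̃ z) ∈ U` for `z ∈ U`. [folklore] -/
theorem reflDom_reflDom'_mem {U : Set (boostedKerrBackground Λ c M a).domain} (z : U) :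
    reflDom P c M a (reflDom' P c M a z.1) ∈ U := (reflDom_reflDom' P c M a z.1).symm ▸ z.2

/-- `Q̃` restricted to the preimage of a subset `U` of the domain, a homeomorphism onto `U`. [folklore] -/
def reflDomRestrict (U : Set (boostedKerrBackground Λ c M a).domain) : (reflDom P c M a ⁻¹' U) ≃ₜ U where
  toFun x := ⟨reflDom P c M a x.1, x.2⟩
  invFun z := ⟨reflDom' P c M a z.1, reflDom_reflDom'_mem P c M a z⟩
  left_inv x := Subtype.ext (reflDom'_reflDom P c M a x.1)
  right_inv z := Subtype.ext (reflDom_reflDom' P c M a z.1)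
  continuous_toFun := ((reflDomHomeo P c M a).continuous.comp continuous_subtype_val).subtype_mk _
  continuous_invFun := ((reflDomHomeo P c M a).symm.continuous.comp continuous_subtype_val).subtype_mk _

/-- Open embeddings restrict along `Q̃`. [folklore] -/
theorem isOpenEmbedding_restrict_relabelChart {U : Set (boostedKerrBackground Λ c M a).domain}
    (hΨ : IsOpenEmbedding (U.restrict Ψ)) :
    IsOpenEmbedding ((reflDom P c M a ⁻¹' U).restrict (relabelChart P c M a Ψ)) := by
  have h : (reflDom P c M a ⁻¹' U).restrict (relabelChart P c M a Ψ) = U.restrict Ψ ∘ reflDomRestrict P c M a U := rfl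
  rw [h]
  exact hΨ.comp (reflDomRestrict P c M a U).isOpenEmbedding

/-- The relabelled chart is the parametrisation `Ψ ∘ (chartAt x₀)⁻¹` composed with `Q̃`, on the domain. [folklore] -/
theorem relabelChart_eq_comp (x₀ : (boostedKerrBackground Λ c M a).domain) :
    relabelChart P c M a Ψ =
      ((Ψ ∘ (chartAt E4 x₀).symm) ∘ reflAffine P c) ∘ (Subtype.val : (boostedKerrBackground (relabelMotion P) c M a).domain → E4) := by
  funext x
  simp only [Function.comp_apply, relabelChart]
  congr 1
  exact Subtype.ext (OpensChart.chartAt_symm_val x₀ (reflDom P c M a x).2).symm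

/-- **Differential of the relabelled chart**: `d(Ψ ∘ Q̃)_x v = dΨ_{Q̃ x} (L v)`. [folklore] -/
theorem mfderiv_relabelChart_apply (x : (boostedKerrBackground (relabelMotion P) c M a).domain)
    (hΨ : MDifferentiableAt 𝓘(ℝ, E4) (𝓡 4) Ψ (reflDom P c M a x)) (v : E4) :
    mfderiv 𝓘(ℝ, E4) (𝓡 4) (relabelChart P c M a Ψ) x v =
      mfderiv 𝓘(ℝ, E4) (𝓡 4) Ψ (reflDom P c M a x) (((labRefl P : lorentzGroup) : E4 ≃L[ℝ] E4) v) := by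
  set x₀ := reflDom P c M a x with hx₀
  set ψ : E4 → 𝓢.carrier := Ψ ∘ (chartAt E4 x₀).symm with hψ
  have hψd : MDifferentiableAt 𝓘(ℝ, E4) (𝓡 4) ψ (reflAffine P c x.1) :=
    𝓢.mdifferentiableAt_comp_chartAt_symm _ Ψ x₀ x₀.2 hΨ
  have hθ : MDifferentiableAt 𝓘(ℝ, E4) 𝓘(ℝ, E4) (reflAffine P c) x.1 :=
    mdifferentiableAt_iff_differentiableAt.mpr (((contDiff_reflAffine P c).differentiable (by simp)) _)
  have hcomp : MDifferentiableAt 𝓘(ℝ, E4) (𝓡 4) (ψ ∘ reflAffine P c) x.1 := hψd.comp x.1 hθ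
  have h1 := 𝓢.mfderiv_comp_subtypeVal_opens (U := (boostedKerrBackground (relabelMotion P) c M a).domain) x hcomp
  rw [← relabelChart_eq_comp P c M a Ψ x₀] at h1
  rw [h1, mfderiv_comp x.1 hψd hθ, mfderiv_eq_fderiv, fderiv_reflAffine]
  exact 𝓢.mfderiv_comp_chartAt_symm_apply _ Ψ x₀ x₀.2 hΨ (((labRefl P : lorentzGroup) : E4 ≃L[ℝ] E4) v)

/-- **Deviation of the relabelled chart** (pointwise, on the domain): the deviation of `Ψ ∘ Q̃` from the
relabelled background is the pullback along `Q̃` of the deviation of `Ψ`. [folklore] -/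
theorem deviationExtend_relabelChart_of_mdifferentiableAt
    (x : (boostedKerrBackground (relabelMotion P) c M a).domain)
    (hΨ : MDifferentiableAt 𝓘(ℝ, E4) (𝓡 4) Ψ (reflDom P c M a x)) :
    𝓢.deviationExtend (boostedKerrBackground (relabelMotion P) c M a) (relabelChart P c M a Ψ) x.1 =
      bilinPullback (reflAffine P c) (𝓢.deviationExtend (boostedKerrBackground Λ c M a) Ψ) x.1 := by
  set x₀ := reflDom P c M a x with hx₀
  set ψ : E4 → 𝓢.carrier := Ψ ∘ (chartAt E4 x₀).symm with hψ
  have hψd : MDifferentiableAt 𝓘(ℝ, E4) (𝓡 4) ψ (reflAffine P c x.1) :=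
    𝓢.mdifferentiableAt_comp_chartAt_symm _ Ψ x₀ x₀.2 hΨ
  have hθ : DifferentiableAt ℝ (reflAffine P c) x.1 := ((contDiff_reflAffine P c).differentiable (by simp)) _
  have hcomp : MDifferentiableAt 𝓘(ℝ, E4) (𝓡 4) (ψ ∘ reflAffine P c) x.1 :=
    hψd.comp x.1 (mdifferentiableAt_iff_differentiableAt.mpr hθ)
  have h1 : 𝓢.deviation (boostedKerrBackground (relabelMotion P) c M a) (relabelChart P c M a Ψ) x =
      𝓢.metricInCoords (ψ ∘ reflAffine P c) x.1 - (boostedKerrBackground (relabelMotion P) c M a).bilin x.1 := by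
    have h := 𝓢.pullbackBilin_comp_subtypeVal_eq_metricInCoords
      (U := (boostedKerrBackground (relabelMotion P) c M a).domain) x hcomp
    rw [← relabelChart_eq_comp P c M a Ψ x₀] at h
    rw [← h]
    rfl
  rw [𝓢.deviationExtend_coe _ _ x, h1, 𝓢.metricInCoords_comp hψd hθ]
  have h4 : 𝓢.metricInCoords ψ (reflAffine P c x.1) =
      𝓢.deviationExtend (boostedKerrBackground Λ c M a) Ψ (reflAffine P c x.1) +
        (boostedKerrBackground Λ c M a).bilin (reflAffine P c x.1) :=
    𝓢.metricInCoords_comp_chartAt_symm_eq_deviationExtend_add (boostedKerrBackground Λ c M a) Ψ x₀ x₀.2 hΨ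
  have h3 : bilinPullback (reflAffine P c) (𝓢.metricInCoords ψ) x.1 =
      bilinPullback (reflAffine P c) (𝓢.deviationExtend (boostedKerrBackground Λ c M a) Ψ) x.1 +
        bilinPullback (reflAffine P c) (boostedKerrBackground Λ c M a).bilin x.1 := by
    ext v w
    rw [bilinPullback_apply, h4]
    rfl
  rw [boostedKerrBackground_relabelMotion_bilin, h3]
  ext v w
  simp

/-- The same for a chart smooth on all of the domain: a global identity of functions on `E4`. [folklore] -/
theorem deviationExtend_relabelChart (hΨ : ContMDiff 𝓘(ℝ, E4) (𝓡 4) ∞ Ψ) :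
    𝓢.deviationExtend (boostedKerrBackground (relabelMotion P) c M a) (relabelChart P c M a Ψ) =
      bilinPullback (reflAffine P c) (𝓢.deviationExtend (boostedKerrBackground Λ c M a) Ψ) := by
  funext y
  by_cases hy : y ∈ (boostedKerrBackground (relabelMotion P) c M a).domain
  · exact deviationExtend_relabelChart_of_mdifferentiableAt P c M a Ψ ⟨y, hy⟩
      ((hΨ _).mdifferentiableAt (by simp))
  · rw [𝓢.deviationExtend_of_not_mem _ _ hy]
    have hy' : reflAffine P c y ∉ (boostedKerrBackground Λ c M a).domain := fun h ↦
      hy ((mem_boostedKerrExterior_relabelMotion_iff P c M a y).2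
        ((mem_boostedKerrExterior_reflAffine_iff P c M a y).1 h))
    ext v w
    rw [bilinPullback_apply, 𝓢.deviationExtend_of_not_mem _ _ hy']
    rfl

/-- **`Cᵏ` sup norms of the deviation are unchanged by relabelling** (chart smooth on a neighbourhood of the
set): for `S' ⊆ U'` with `U'` open and `Ψ` differentiable on `Q̃(U')`,
`supCkENorm (val '' S') k (dev of Ψ ∘ Q̃) = supCkENorm (val '' Q̃(S')) k (dev of Ψ)`. [folklore] -/
theorem supCkENorm_deviationExtend_relabelChart
    {U' S' : Set (boostedKerrBackground (relabelMotion P) c M a).domain} (hU' : IsOpen U') (hS' : S' ⊆ U')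
    (hΨ : ∀ x ∈ U', MDifferentiableAt 𝓘(ℝ, E4) (𝓡 4) Ψ (reflDom P c M a x)) (k : ℕ) :
    supCkENorm (Subtype.val '' S') k
        (𝓢.deviationExtend (boostedKerrBackground (relabelMotion P) c M a) (relabelChart P c M a Ψ)) =
      supCkENorm (Subtype.val '' (reflDom P c M a '' S')) k
        (𝓢.deviationExtend (boostedKerrBackground Λ c M a) Ψ) := by
  have hgerm : ∀ y ∈ Subtype.val '' S',
      𝓢.deviationExtend (boostedKerrBackground (relabelMotion P) c M a) (relabelChart P c M a Ψ) =ᶠ[𝓝 y]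
        bilinPullback (reflAffine P c) (𝓢.deviationExtend (boostedKerrBackground Λ c M a) Ψ) := by
    rintro _ ⟨x, hx, rfl⟩
    have hopen : IsOpen (Subtype.val '' U') :=
      (boostedKerrBackground (relabelMotion P) c M a).domain.2.isOpenMap_subtype_val U' hU'
    filter_upwards [hopen.mem_nhds ⟨x, hS' hx, rfl⟩] with z hz
    obtain ⟨x', hx', rfl⟩ := hz
    exact deviationExtend_relabelChart_of_mdifferentiableAt P c M a Ψ x' (hΨ x' hx')
  rw [supCkENorm_congr hgerm, supCkENorm_bilinPullback_affine (labReflIso P) c c (reflAffine_eq_labReflIso P c),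
    Set.image_image, Set.image_image]
  rfl

end ChartTransfer

/-! ## §5 Transfer of the chart clauses of a final-state decomposition / gap certificate along `Q̃` -/

section Transfer

variable {𝓢 : Spacetime.{0} 4} {Λ : lorentzGroup} (P : ParityDatum Λ) (c : E4) (M a : ℝ)
variable (Ψ : (boostedKerrBackground Λ c M a).domain → 𝓢.carrier)

/-- `(t, r, x⁰)`-sets are `Q̃`-invariant (hole clock, hole radius and flat time are preserved). [folklore] -/
theorem image_reflDom_setOf (pr : ℝ → ℝ → ℝ → Prop) :
    reflDom P c M a '' {x | pr ((boostedKerrBackground (relabelMotion P) c M a).time x.1)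
        ((boostedKerrBackground (relabelMotion P) c M a).radius x.1) (x.1 0)} =
      {x | pr ((boostedKerrBackground Λ c M a).time x.1) ((boostedKerrBackground Λ c M a).radius x.1) (x.1 0)} := by
  refine image_reflDom_eq P c M a fun x ↦ ?_
  simp only [Set.mem_setOf_eq, reflDom_val, time_reflAffine, radius_reflAffine, reflAffine_apply_zero,
    boostedKerrBackground_relabelMotion_time, boostedKerrBackground_relabelMotion_radius]

/-- Preimages of `(t, r, x⁰)`-sets under `Q̃` are the same `(t, r, x⁰)`-sets. [folklore] -/
theorem preimage_reflDom_setOf (pr : ℝ → ℝ → ℝ → Prop) :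
    reflDom P c M a ⁻¹' {x | pr ((boostedKerrBackground Λ c M a).time x.1)
        ((boostedKerrBackground Λ c M a).radius x.1) (x.1 0)} =
      {x | pr ((boostedKerrBackground (relabelMotion P) c M a).time x.1)
        ((boostedKerrBackground (relabelMotion P) c M a).radius x.1) (x.1 0)} := by
  ext x
  simp only [Set.mem_preimage, Set.mem_setOf_eq, reflDom_val, time_reflAffine, radius_reflAffine,
    reflAffine_apply_zero, boostedKerrBackground_relabelMotion_time, boostedKerrBackground_relabelMotion_radius]

/-- Images of `(t, r, x⁰)`-sets under the relabelled chart are the images under the original chart. [folklore] -/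
theorem image_relabelChart_setOf (pr : ℝ → ℝ → ℝ → Prop) :
    relabelChart P c M a Ψ '' {x | pr ((boostedKerrBackground (relabelMotion P) c M a).time x.1)
        ((boostedKerrBackground (relabelMotion P) c M a).radius x.1) (x.1 0)} =
      Ψ '' {x | pr ((boostedKerrBackground Λ c M a).time x.1) ((boostedKerrBackground Λ c M a).radius x.1) (x.1 0)} := by
  rw [image_relabelChart, image_reflDom_setOf]

/-- The late region of the relabelled background is the `Q̃`-preimage of the old one. [folklore] -/
theorem lateRegion_relabel_eq (τ₀ : ℝ) :
    (boostedKerrBackground (relabelMotion P) c M a).lateRegion τ₀ =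
      reflDom P c M a ⁻¹' (boostedKerrBackground Λ c M a).lateRegion τ₀ :=
  (preimage_reflDom_setOf P c M a (fun t _ _ ↦ τ₀ < t)).symm

/-- Same image of the late region. [folklore] -/
theorem image_relabelChart_lateRegion (τ₀ : ℝ) :
    relabelChart P c M a Ψ '' (boostedKerrBackground (relabelMotion P) c M a).lateRegion τ₀ =
      Ψ '' (boostedKerrBackground Λ c M a).lateRegion τ₀ :=
  image_relabelChart_setOf P c M a Ψ (fun t _ _ ↦ τ₀ < t)

/-- Same image of every time slab. [folklore] -/
theorem image_relabelChart_timeSlab (τ : ℝ) :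
    relabelChart P c M a Ψ '' (boostedKerrBackground (relabelMotion P) c M a).timeSlab τ =
      Ψ '' (boostedKerrBackground Λ c M a).timeSlab τ :=
  image_relabelChart_setOf P c M a Ψ (fun t _ _ ↦ t = τ)

/-- Same image of every truncated time slab. [folklore] -/
theorem image_relabelChart_truncTimeSlab (R τ : ℝ) :
    relabelChart P c M a Ψ '' (boostedKerrBackground (relabelMotion P) c M a).truncTimeSlab R τ =
      Ψ '' (boostedKerrBackground Λ c M a).truncTimeSlab R τ :=
  image_relabelChart_setOf P c M a Ψ (fun t r _ ↦ t = τ ∧ r ≤ R)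

/-- Same image of every truncated late region. [folklore] -/
theorem image_relabelChart_truncLateRegion (τ₁ R : ℝ) :
    relabelChart P c M a Ψ '' (boostedKerrBackground (relabelMotion P) c M a).truncLateRegion τ₁ R =
      Ψ '' (boostedKerrBackground Λ c M a).truncLateRegion τ₁ R :=
  image_relabelChart_setOf P c M a Ψ (fun t r _ ↦ τ₁ < t ∧ r ≤ R)

/-- **Late charts relabel to late charts** (same region, same initial time). [folklore] -/
theorem isLateChart_relabelChart {O : Set 𝓢.carrier} {τ₀ : ℝ}
    (hΨ : 𝓢.IsLateChart (boostedKerrBackground Λ c M a) O τ₀ Ψ) :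
    𝓢.IsLateChart (boostedKerrBackground (relabelMotion P) c M a) O τ₀ (relabelChart P c M a Ψ) where
  contMDiff := contMDiff_relabelChart P c M a Ψ hΨ.contMDiff
  isOpenEmbedding := by
    rw [lateRegion_relabel_eq]
    exact isOpenEmbedding_restrict_relabelChart P c M a Ψ hΨ.isOpenEmbedding
  image_subset := by
    rw [image_relabelChart_lateRegion]
    exact hΨ.image_subset

/-- **Truncated `Cᵏ` deviations are unchanged by relabelling** (chart smooth on the domain). [folklore] -/
theorem truncDeviationCk_relabelChart (hΨ : ContMDiff 𝓘(ℝ, E4) (𝓡 4) ∞ Ψ) (k : ℕ) (R τ : ℝ) :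
    𝓢.truncDeviationCk (boostedKerrBackground (relabelMotion P) c M a) (relabelChart P c M a Ψ) k R τ =
      𝓢.truncDeviationCk (boostedKerrBackground Λ c M a) Ψ k R τ := by
  unfold Spacetime.truncDeviationCk
  rw [supCkENorm_deviationExtend_relabelChart P c M a Ψ isOpen_univ (Set.subset_univ _)
    (fun x _ ↦ (hΨ _).mdifferentiableAt (by simp)) k]
  congr 2
  exact image_reflDom_setOf P c M a (fun t r _ ↦ t = τ ∧ r ≤ R)

/-- **`Cᵏ` sup norms of the deviation over `(t, r, x⁰)`-subsets of an open `(t, r, x⁰)`-set on which the chart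
is smooth are unchanged by relabelling** (the shape of G3 / K8 / K9 / `HonestFar`(3) at `N = 1`). [folklore] -/
theorem supCkENorm_deviationExtend_relabelChart_setOf (PU PS : ℝ → ℝ → ℝ → Prop)
    (hU : IsOpen {x : (boostedKerrBackground Λ c M a).domain |
      PU ((boostedKerrBackground Λ c M a).time x.1) ((boostedKerrBackground Λ c M a).radius x.1) (x.1 0)})
    (hSU : ∀ t r s, PS t r s → PU t r s)
    (hΨ : ContMDiffOn 𝓘(ℝ, E4) (𝓡 4) ∞ Ψ {x |
      PU ((boostedKerrBackground Λ c M a).time x.1) ((boostedKerrBackground Λ c M a).radius x.1) (x.1 0)}) (k : ℕ) :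
    supCkENorm (Subtype.val '' {x : (boostedKerrBackground (relabelMotion P) c M a).domain |
        PS ((boostedKerrBackground (relabelMotion P) c M a).time x.1)
          ((boostedKerrBackground (relabelMotion P) c M a).radius x.1) (x.1 0)}) k
        (𝓢.deviationExtend (boostedKerrBackground (relabelMotion P) c M a) (relabelChart P c M a Ψ)) =
      supCkENorm (Subtype.val '' {x : (boostedKerrBackground Λ c M a).domain |
        PS ((boostedKerrBackground Λ c M a).time x.1) ((boostedKerrBackground Λ c M a).radius x.1) (x.1 0)}) k
        (𝓢.deviationExtend (boostedKerrBackground Λ c M a) Ψ) := by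
  have hU' : IsOpen (reflDom P c M a ⁻¹' {x : (boostedKerrBackground Λ c M a).domain |
      PU ((boostedKerrBackground Λ c M a).time x.1) ((boostedKerrBackground Λ c M a).radius x.1) (x.1 0)}) :=
    hU.preimage (reflDomHomeo P c M a).continuous
  rw [supCkENorm_deviationExtend_relabelChart P c M a Ψ hU' ?_ ?_ k, image_reflDom_setOf]
  · intro x hx
    rw [preimage_reflDom_setOf]
    simp only [Set.mem_setOf_eq, boostedKerrBackground_relabelMotion_time,
      boostedKerrBackground_relabelMotion_radius] at hx ⊢
    exact hSU _ _ _ hx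
  · intro x hx
    exact (hΨ _ hx).contMDiffAt (hU.mem_nhds hx) |>.mdifferentiableAt (by simp)

/-- **Time-line vectors of the relabelled chart**: `d(Ψ ∘ Q̃)_x ((ΛQ) ∂₀) = dΨ_{Q̃ x} (Λ ∂₀)` — so the
future-directedness clauses (G4, K10, `HonestCore`(4)-shape) transfer verbatim. [folklore] -/
theorem mfderiv_relabelChart_motion_basisVector_zero
    (x : (boostedKerrBackground (relabelMotion P) c M a).domain)
    (hΨ : MDifferentiableAt 𝓘(ℝ, E4) (𝓡 4) Ψ (reflDom P c M a x)) :
    mfderiv 𝓘(ℝ, E4) (𝓡 4) (relabelChart P c M a Ψ) x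
        (((relabelMotion P : lorentzGroup) : E4 ≃L[ℝ] E4) (E4.basisVector 0)) =
      mfderiv 𝓘(ℝ, E4) (𝓡 4) Ψ (reflDom P c M a x) ((Λ : E4 ≃L[ℝ] E4) (E4.basisVector 0)) := by
  rw [relabelMotion_basisVector_zero, mfderiv_relabelChart_apply P c M a Ψ x hΨ, labRefl_map_motion_basisVector_zero]

/-- Pointwise agreement transfers: if `Ψg = Ψ` on a `(t, r, x⁰)`-set then the relabelled charts agree on the
same set (the pin G-clause / K6-shape). [folklore] -/
theorem relabelChart_eq_of_eq {Ψg : (boostedKerrBackground Λ c M a).domain → 𝓢.carrier} (pr : ℝ → ℝ → ℝ → Prop)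
    (h : ∀ x : (boostedKerrBackground Λ c M a).domain,
      pr ((boostedKerrBackground Λ c M a).time x.1) ((boostedKerrBackground Λ c M a).radius x.1) (x.1 0) → Ψg x = Ψ x)
    (x : (boostedKerrBackground (relabelMotion P) c M a).domain)
    (hx : pr ((boostedKerrBackground (relabelMotion P) c M a).time x.1)
      ((boostedKerrBackground (relabelMotion P) c M a).radius x.1) (x.1 0)) :
    relabelChart P c M a Ψg x = relabelChart P c M a Ψ x := by
  refine h (reflDom P c M a x) ?_
  simpa only [reflDom_val, time_reflAffine, radius_reflAffine, reflAffine_apply_zero,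
    boostedKerrBackground_relabelMotion_time, boostedKerrBackground_relabelMotion_radius] using hx

end Transfer

/-- **Registered brick `stub_deviationExtendParity`**, definition-free form of `deviationExtend_relabelChart`: for a
Lorentz involution `Q` fixing `∂₀`, `Λ⁻¹∂₀`, `x³` and ANY map `θ` between the exteriors of `(Λ Q, c)` and `(Λ, c)`
over `Q̃ = c + ΛQΛ⁻¹(· − c)`, the deviation of `Ψ ∘ θ` is the `Q̃`-pullback of that of `Ψ` (DHRT §1). [folklore] -/
theorem stub_deviationExtendParity {𝓢 : Spacetime.{0} 4} (Λ Q : lorentzGroup) (c : E4) (M a : ℝ)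
    (hQQ : ∀ v, (Q : E4 ≃L[ℝ] E4) ((Q : E4 ≃L[ℝ] E4) v) = v)
    (hQ0 : (Q : E4 ≃L[ℝ] E4) (E4.basisVector 0) = E4.basisVector 0)
    (hQu : (Q : E4 ≃L[ℝ] E4) ((Λ : E4 ≃L[ℝ] E4).symm (E4.basisVector 0)) =
      (Λ : E4 ≃L[ℝ] E4).symm (E4.basisVector 0))
    (hQ3 : ∀ v, (Q : E4 ≃L[ℝ] E4) v 3 = v 3)
    (θ : (boostedKerrBackground (Λ * Q) c M a).domain → (boostedKerrBackground Λ c M a).domain)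
    (hθ : ∀ x, (θ x).1 = c + ((Λ * Q * Λ⁻¹ : lorentzGroup) : E4 ≃L[ℝ] E4) (x.1 - c))
    (Ψ : (boostedKerrBackground Λ c M a).domain → 𝓢.carrier) (hΨ : ContMDiff 𝓘(ℝ, E4) (𝓡 4) ∞ Ψ) :
    𝓢.deviationExtend (boostedKerrBackground (Λ * Q) c M a) (Ψ ∘ θ) =
      bilinPullback (fun x ↦ c + ((Λ * Q * Λ⁻¹ : lorentzGroup) : E4 ≃L[ℝ] E4) (x - c))
        (𝓢.deviationExtend (boostedKerrBackground Λ c M a) Ψ) := by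
  let P : ParityDatum Λ := ⟨Q, hQQ, hQ0, hQu, hQ3⟩
  have e : (fun x ↦ c + ((Λ * Q * Λ⁻¹ : lorentzGroup) : E4 ≃L[ℝ] E4) (x - c)) = reflAffine P c := rfl
  have hθ' : θ = reflDom P c M a := by
    funext x; apply Subtype.ext; rw [reflDom_val, ← e]; exact hθ x
  rw [e, hθ']
  exact deviationExtend_relabelChart P c M a Ψ hΨ

end Summit.FinalStateConjecture.FinalStateConjecture.Theorems.GapDecaySuffices.Relabel
end
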